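import Literature.Probability.Percolation.CellBoundary
import Literature.Topology.PlaneTopology.JordanNesting
import Literature.Topology.PlaneTopology.WindingNumberCrossing
import HarnessLib

/-!
# Cells inside and outside the traced boundary loop of a cell complex

Topic `Probability/Percolation`.  Second step of "a pinch-free hole-free finite union of closed unit
cells of `ℤ²` is a closed Jordan domain" (support for the quads of the gluing theorem,
Schramm–Smirnov 2011, proof of Thm 1.5).  `CellBoundary.lean` traces the boundary darts of a
finite `U ⊆ ℤ²` into simple closed polygons; here we read the traced loop
`γ = polygonLoop (traceList U d₀ h₀)` as a Jordan loop (`IsJordanLoop`,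
`Topology/PlaneTopology/JordanSweepParity.lean`) and locate the cells:

* `ctr c`, the centre of the cell `c`, is never on the loop (`ctr_not_mem_range`);
* two cells sharing an edge that is not traced have their centres on the same side
  (`sameSide_of_not_traced`: the segment between the centres misses the loop);
* the two cells of a traced edge have their centres on opposite sides (`inside_left_iff_not_inside_right`:
  the winding number jumps by one across a straight piece of the loop,
  `wind_sub_wind_of_straight_cross`, and is constant on the inside);
* consequently, if `U` is edge-connected, every non-`U` cell adjacent to `U` is joined to far away
  through non-`U` cells (`CoHoleFree`), and the start dart is traced with its outer cell outside,
  then all cells of `U` are inside and **every boundary dart of `U` lies on the traced loop**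
  (`forall_isBd_exists_eq_bdOrbit`): the complex has a single boundary cycle.

Everything is proved; no named fact is introduced.

## References

* O. Schramm, S. Smirnov, Ann. Probab. 39 (2011), arXiv:1101.5820, proof of Thm 1.5. [SchrammSmirnov2011]
* J. McCleary, *A First Course in Topology* (2006), Ch. 9 (Jordan curve theorem). [Mccleary2006]
-/

noncomputable section

open Set Metric
open Literature.Probability.LatticeModels
open Literature.Probability.RandomPlanarGeometry
open Literature.Topology.PlaneTopology

namespace Literature.Probability.Percolation

namespace CellComplex

/-! ### Cells, centres, edge segments -/

/-- The centre of the cell with lower-left corner `c` (mesh `1`). [folklore] -/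
def ctr (c : Site 2) : ℂ := Site.toComplex c + ⟨1 / 2, 1 / 2⟩

/-- Real part of a centre. [folklore] -/
@[simp] theorem ctr_re (c : Site 2) : (ctr c).re = (c 0 : ℝ) + 1 / 2 := by simp [ctr]

/-- Imaginary part of a centre. [folklore] -/
@[simp] theorem ctr_im (c : Site 2) : (ctr c).im = (c 1 : ℝ) + 1 / 2 := by simp [ctr]

/-- The closed segment of the unit edge from `v` in direction `k`. [folklore] -/
def edgeSeg (v : Site 2) (k : Fin 4) : Set ℂ := segment ℝ (Site.toComplex v) (Site.toComplex (v + cornerUnit k))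

/-- A point of a unit edge has an integer coordinate matching its start. [folklore] -/
theorem exists_of_mem_edgeSeg {v : Site 2} {k : Fin 4} {p : ℂ} (hp : p ∈ edgeSeg v k) :
    ∃ t : ℝ, 0 ≤ t ∧ t ≤ 1 ∧ p = Site.toComplex v + (t : ℂ) * Site.toComplex (cornerUnit k) := by
  rw [edgeSeg, segment_eq_image_lineMap] at hp
  obtain ⟨t, ⟨h0, h1⟩, rfl⟩ := hp
  refine ⟨t, h0, h1, ?_⟩
  simp only [AffineMap.lineMap_apply_module', toComplex_add, add_sub_cancel_left, Complex.real_smul]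
  ring

/-- **Centres are off every unit edge.** [folklore] -/
theorem ctr_not_mem_edgeSeg (c v : Site 2) (k : Fin 4) : ctr c ∉ edgeSeg v k := by
  intro h
  obtain ⟨t, ht0, ht1, heq⟩ := exists_of_mem_edgeSeg h
  rw [Complex.ext_iff] at heq
  obtain ⟨hre, him⟩ := heq
  fin_cases k <;> norm_num [toComplex_cornerUnit_table] at hre him
  · -- horizontal: imaginary parts `c 1 + 1/2 = v 1`
    have : (2 : ℝ) * c 1 + 1 = 2 * v 1 := by linarith
    have h2 : (2 * c 1 + 1 : ℤ) = 2 * v 1 := by exact_mod_cast this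
    omega
  · have : (2 : ℝ) * c 0 + 1 = 2 * v 0 := by linarith
    have h2 : (2 * c 0 + 1 : ℤ) = 2 * v 0 := by exact_mod_cast this
    omega
  · have : (2 : ℝ) * c 1 + 1 = 2 * v 1 := by linarith
    have h2 : (2 * c 1 + 1 : ℤ) = 2 * v 1 := by exact_mod_cast this
    omega
  · have : (2 : ℝ) * c 0 + 1 = 2 * v 0 := by linarith
    have h2 : (2 * c 0 + 1 : ℤ) = 2 * v 0 := by exact_mod_cast this
    omega

/-! ### The traced loop as a Jordan loop -/

section Loop

variable {U : Finset (Site 2)} {d₀ : Site 2 × Fin 4} (h₀ : IsBd U d₀)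

variable (U d₀) in
/-- The traced boundary loop. [folklore] -/
def bdLoop (h₀ : IsBd U d₀) : ℝ → ℂ := polygonLoop (traceList U d₀ h₀)

/-- The traced loop is a Jordan loop (pinch-free complexes). [folklore] -/
theorem isJordanLoop_bdLoop (hP : PinchFree U) : IsJordanLoop (bdLoop U d₀ h₀) :=
  ⟨continuous_polygonLoop _, periodic_polygonLoop _,
    injOn_polygonLoop (isSimpleClosedPolygon_traceList h₀ hP)⟩

/-- The traced list is nonempty. [folklore] -/
theorem traceList_ne_nil : traceList U d₀ h₀ ≠ [] :=
  List.ne_nil_of_length_pos (by rw [length_traceList]; exact period_pos h₀)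

/-- **The range of the traced loop is the union of the traced edges.** [folklore] -/
theorem range_bdLoop : range (bdLoop U d₀ h₀) = ⋃ i ∈ Iio (period h₀), edgeSeg (vert U d₀ i) (dirAt U d₀ i) := by
  rw [bdLoop, range_polygonLoop (traceList_ne_nil h₀)]
  ext p
  simp only [mem_iUnion, mem_Iio, exists_prop]
  constructor
  · rintro ⟨⟨i, hi⟩, hp⟩
    have hi' : i < period h₀ := by simpa using hi
    refine ⟨i, hi', ?_⟩
    rwa [getElem_traceList, getElem_traceList_succ_mod h₀ hi', vert_succ] at hp
  · rintro ⟨i, hi, hp⟩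
    refine ⟨⟨i, by simpa using hi⟩, ?_⟩
    rwa [getElem_traceList, getElem_traceList_succ_mod h₀ hi, vert_succ]

/-- A point of the loop lies on some traced edge. [folklore] -/
theorem exists_edge_of_mem_range {p : ℂ} (hp : p ∈ range (bdLoop U d₀ h₀)) :
    ∃ i < period h₀, p ∈ edgeSeg (vert U d₀ i) (dirAt U d₀ i) := by
  rw [range_bdLoop] at hp
  simpa only [mem_iUnion, mem_Iio, exists_prop] using hp

/-- Traced edges lie on the loop. [folklore] -/
theorem edgeSeg_subset_range {i : ℕ} (hi : i < period h₀) :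
    edgeSeg (vert U d₀ i) (dirAt U d₀ i) ⊆ range (bdLoop U d₀ h₀) := by
  rw [range_bdLoop]
  exact subset_biUnion_of_mem (u := fun i => edgeSeg (vert U d₀ i) (dirAt U d₀ i)) (mem_Iio.2 hi)

/-- Centres are off the loop. [folklore] -/
theorem ctr_not_mem_range (c : Site 2) : ctr c ∉ range (bdLoop U d₀ h₀) := fun h => by
  obtain ⟨i, -, hi⟩ := exists_edge_of_mem_range h₀ h
  exact ctr_not_mem_edgeSeg c _ _ hi

/-- The piece formula: on `[i/P, (i+1)/P]` the loop runs affinely along the `i`-th traced edge.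
[folklore] -/
theorem bdLoop_apply_div {i : ℕ} (hi : i < period h₀) {θ : ℝ} (hθ : θ ∈ Icc (0 : ℝ) 1) :
    bdLoop U d₀ h₀ ((i + θ) / period h₀) =
      AffineMap.lineMap (Site.toComplex (vert U d₀ i)) (Site.toComplex (vert U d₀ i + cornerUnit (dirAt U d₀ i))) θ := by
  have hi' : i < (traceList U d₀ h₀).length := by simpa using hi
  have := polygonLoop_apply_div hi' hθ
  rw [getElem_traceList, getElem_traceList_succ_mod h₀ hi, vert_succ] at this
  simpa [bdLoop] using this

end Loop

/-! ### The segment between the centres of the two cells of an edge -/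

/-- The segment joining the centres of the left and right cells of the unit edge `(v, k)`. [folklore] -/
def ctrSeg (v : Site 2) (k : Fin 4) : Set ℂ := segment ℝ (ctr (faceAt v k)) (ctr (faceAt v (k + 3)))

/-- The midpoint of the unit edge `(v, k)`. [folklore] -/
def emid (v : Site 2) (k : Fin 4) : ℂ := Site.toComplex v + (1 / 2 : ℂ) * Site.toComplex (cornerUnit k)

/-- Points of the centre segment in coordinates. [folklore] -/
theorem exists_of_mem_ctrSeg {v : Site 2} {k : Fin 4} {p : ℂ} (hp : p ∈ ctrSeg v k) :
    ∃ s : ℝ, 0 ≤ s ∧ s ≤ 1 ∧ p = ctr (faceAt v k) + (s : ℂ) * (ctr (faceAt v (k + 3)) - ctr (faceAt v k)) := by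
  rw [ctrSeg, segment_eq_image_lineMap] at hp
  obtain ⟨s, ⟨h0, h1⟩, rfl⟩ := hp
  refine ⟨s, h0, h1, ?_⟩
  simp only [AffineMap.lineMap_apply_module', Complex.real_smul]
  ring

/-- Centre of the left cell of `(v, k)`, real part. [folklore] -/
theorem ctr_left_re (v : Site 2) (k : Fin 4) : (ctr (faceAt v k)).re =
    v 0 + (match k with | 0 => 1 / 2 | 1 => -1 / 2 | 2 => -1 / 2 | 3 => 1 / 2 : ℝ) := by
  fin_cases k <;> simp [ctr, faceAt, cornerOff, Site.toComplex] <;> ring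

/-- Centre of the left cell of `(v, k)`, imaginary part. [folklore] -/
theorem ctr_left_im (v : Site 2) (k : Fin 4) : (ctr (faceAt v k)).im =
    v 1 + (match k with | 0 => 1 / 2 | 1 => 1 / 2 | 2 => -1 / 2 | 3 => -1 / 2 : ℝ) := by
  fin_cases k <;> simp [ctr, faceAt, cornerOff, Site.toComplex] <;> ring

/-- Centre of the right cell of `(v, k)`, real part. [folklore] -/
theorem ctr_right_re (v : Site 2) (k : Fin 4) : (ctr (faceAt v (k + 3))).re =
    v 0 + (match k with | 0 => 1 / 2 | 1 => 1 / 2 | 2 => -1 / 2 | 3 => -1 / 2 : ℝ) := by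
  fin_cases k <;> simp [ctr, faceAt, cornerOff, Site.toComplex] <;> ring

/-- Centre of the right cell of `(v, k)`, imaginary part. [folklore] -/
theorem ctr_right_im (v : Site 2) (k : Fin 4) : (ctr (faceAt v (k + 3))).im =
    v 1 + (match k with | 0 => -1 / 2 | 1 => 1 / 2 | 2 => 1 / 2 | 3 => -1 / 2 : ℝ) := by
  fin_cases k <;> simp [ctr, faceAt, cornerOff, Site.toComplex] <;> ring

/-- **A unit edge meeting the centre segment of `(v, k)` is the edge `(v, k)` itself** (possibly
reversed). [folklore] -/
theorem edge_eq_of_mem_ctrSeg {v v' : Site 2} {k k' : Fin 4} {p : ℂ} (hp : p ∈ ctrSeg v k)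
    (hp' : p ∈ edgeSeg v' k') :
    (v' = v ∧ k' = k) ∨ (v' = v + cornerUnit k ∧ k' = k + 2) := by
  obtain ⟨s, hs0, hs1, hps⟩ := exists_of_mem_ctrSeg hp
  obtain ⟨t, ht0, ht1, hpt⟩ := exists_of_mem_edgeSeg hp'
  have heq := hps.symm.trans hpt
  rw [Complex.ext_iff] at heq
  obtain ⟨hre, him⟩ := heq
  have hv : ∀ w w' : Site 2, w' = w ↔ (w' 0 = w 0 ∧ w' 1 = w 1) := fun w w' =>
    ⟨fun h => by subst h; exact ⟨rfl, rfl⟩, fun h => by funext i; fin_cases i <;> simp [h.1, h.2]⟩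
  have hunit : ∀ (w : Site 2) (j : Fin 4) (i : Fin 2), (w + cornerUnit j) i =
      (match j with
        | 0 => fun i => if i = 0 then w 0 + 1 else w 1
        | 1 => fun i => if i = 0 then w 0 else w 1 + 1
        | 2 => fun i => if i = 0 then w 0 - 1 else w 1
        | 3 => fun i => if i = 0 then w 0 else w 1 - 1) i := by
    intro w j i
    fin_cases j <;> fin_cases i <;> simp [cornerUnit] <;> ring
  simp only [Complex.add_re, Complex.add_im, Complex.sub_re, Complex.sub_im, Complex.mul_re,
    Complex.mul_im, Complex.ofReal_re, Complex.ofReal_im, zero_mul, sub_zero, add_zero] at hre him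
  rw [ctr_right_re, ctr_left_re, Site.toComplex_re v'] at hre
  rw [ctr_right_im, ctr_left_im, Site.toComplex_im v'] at him
  fin_cases k <;> fin_cases k' <;> norm_num [toComplex_cornerUnit_table] at hre him
  -- k = 0 (east): the centre segment is vertical at `re = v 0 + 1/2`, `im ∈ [v 1 - 1/2, v 1 + 1/2]`
  · -- k' = 0: horizontal edge at height `v' 1` with `re ∈ [v' 0, v' 0 + 1]`
    left
    have h1 : (2 : ℝ) * v 1 + 1 - 2 * s = 2 * v' 1 := by linarith
    have h1' : ∃ m : ℤ, (2 : ℝ) * s = m := ⟨2 * v 1 + 1 - 2 * v' 1, by push_cast; linarith⟩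
    obtain ⟨m, hm⟩ := h1'
    have hm0 : (0 : ℝ) ≤ m := by rw [← hm]; linarith
    have hm2 : (m : ℝ) ≤ 2 := by rw [← hm]; linarith
    have h0 : (2 : ℝ) * v 0 + 1 = 2 * v' 0 + 2 * t := by linarith
    -- `t ∈ [0,1]` and parity force `2t = 1`, `v' 0 = v 0`
    have ht' : ∃ n : ℤ, (2 : ℝ) * t = n := ⟨2 * v 0 + 1 - 2 * v' 0, by push_cast; linarith⟩
    obtain ⟨n, hn⟩ := ht'
    have hn0 : (0 : ℝ) ≤ n := by rw [← hn]; linarith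
    have hn2 : (n : ℝ) ≤ 2 := by rw [← hn]; linarith
    have hn0' : 0 ≤ n := by exact_mod_cast hn0
    have hn2' : n ≤ 2 := by exact_mod_cast hn2
    have hpar : (2 * v 0 + 1 : ℤ) = 2 * v' 0 + n := by
      have : (2 : ℝ) * v 0 + 1 = 2 * v' 0 + n := by rw [← hn]; exact h0
      exact_mod_cast this
    have hn1 : n = 1 := by omega
    have hv0 : v' 0 = v 0 := by omega
    have hm0' : 0 ≤ m := by exact_mod_cast hm0
    have hm2' : m ≤ 2 := by exact_mod_cast hm2
    have hpar1 : (2 * v 1 + 1 : ℤ) - m = 2 * v' 1 := by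
      have : (2 : ℝ) * v 1 + 1 - m = 2 * v' 1 := by rw [← hm]; exact h1
      exact_mod_cast this
    have hv1 : v' 1 = v 1 := by omega
    exact ⟨(hv v v').2 ⟨hv0, hv1⟩, rfl⟩
  · -- k' = 1: vertical edge at `re = v' 0`: `v' 0 = v 0 + 1/2` impossible
    exfalso
    have : (2 : ℝ) * v' 0 = 2 * v 0 + 1 := by linarith
    have h2 : (2 * v' 0 : ℤ) = 2 * v 0 + 1 := by exact_mod_cast this
    omega
  · -- k' = 2: reversed horizontal edge
    right
    have h0 : (2 : ℝ) * v 0 + 1 = 2 * v' 0 - 2 * t := by linarith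
    have ht' : ∃ n : ℤ, (2 : ℝ) * t = n := ⟨2 * v' 0 - 2 * v 0 - 1, by push_cast; linarith⟩
    obtain ⟨n, hn⟩ := ht'
    have hn0 : (0 : ℝ) ≤ n := by rw [← hn]; linarith
    have hn2 : (n : ℝ) ≤ 2 := by rw [← hn]; linarith
    have hn0' : 0 ≤ n := by exact_mod_cast hn0
    have hn2' : n ≤ 2 := by exact_mod_cast hn2
    have hpar : (2 * v 0 + 1 : ℤ) = 2 * v' 0 - n := by
      have : (2 : ℝ) * v 0 + 1 = 2 * v' 0 - n := by rw [← hn]; exact h0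
      exact_mod_cast this
    have hv0 : v' 0 = v 0 + 1 := by omega
    have h1 : (2 : ℝ) * v 1 + 1 - 2 * s = 2 * v' 1 := by linarith
    have h1' : ∃ m : ℤ, (2 : ℝ) * s = m := ⟨2 * v 1 + 1 - 2 * v' 1, by push_cast; linarith⟩
    obtain ⟨m, hm⟩ := h1'
    have hm0 : (0 : ℝ) ≤ m := by rw [← hm]; linarith
    have hm2 : (m : ℝ) ≤ 2 := by rw [← hm]; linarith
    have hm0' : 0 ≤ m := by exact_mod_cast hm0
    have hm2' : m ≤ 2 := by exact_mod_cast hm2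
    have hpar1 : (2 * v 1 + 1 : ℤ) - m = 2 * v' 1 := by
      have : (2 : ℝ) * v 1 + 1 - m = 2 * v' 1 := by rw [← hm]; exact h1
      exact_mod_cast this
    have hv1 : v' 1 = v 1 := by omega
    refine ⟨(hv _ v').2 ⟨?_, ?_⟩, rfl⟩
    · rw [hunit]; simpa using hv0
    · rw [hunit]; simpa using hv1
  · -- k' = 3: vertical edge, impossible
    exfalso
    have : (2 : ℝ) * v' 0 = 2 * v 0 + 1 := by linarith
    have h2 : (2 * v' 0 : ℤ) = 2 * v 0 + 1 := by exact_mod_cast this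
    omega
  -- k = 1 (north): the centre segment is horizontal at `im = v 1 + 1/2`, `re ∈ [v 0 - 1/2, v 0 + 1/2]`
  · -- k' = 0: horizontal edge at integer height: impossible
    exfalso
    have : (2 : ℝ) * v' 1 = 2 * v 1 + 1 := by linarith
    have h2 : (2 * v' 1 : ℤ) = 2 * v 1 + 1 := by exact_mod_cast this
    omega
  · -- k' = 1: vertical edge from `v'` upwards
    left
    have h1 : (2 : ℝ) * v 1 + 1 = 2 * v' 1 + 2 * t := by linarith
    have ht' : ∃ n : ℤ, (2 : ℝ) * t = n := ⟨2 * v 1 + 1 - 2 * v' 1, by push_cast; linarith⟩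
    obtain ⟨n, hn⟩ := ht'
    have hn0 : (0 : ℝ) ≤ n := by rw [← hn]; linarith
    have hn2 : (n : ℝ) ≤ 2 := by rw [← hn]; linarith
    have hn0' : 0 ≤ n := by exact_mod_cast hn0
    have hn2' : n ≤ 2 := by exact_mod_cast hn2
    have hpar : (2 * v 1 + 1 : ℤ) = 2 * v' 1 + n := by
      have : (2 : ℝ) * v 1 + 1 = 2 * v' 1 + n := by rw [← hn]; exact h1
      exact_mod_cast this
    have hv1 : v' 1 = v 1 := by omega
    have h0 : (2 : ℝ) * v 0 - 1 + 2 * s = 2 * v' 0 := by linarith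
    have h0' : ∃ m : ℤ, (2 : ℝ) * s = m := ⟨2 * v' 0 - 2 * v 0 + 1, by push_cast; linarith⟩
    obtain ⟨m, hm⟩ := h0'
    have hm0 : (0 : ℝ) ≤ m := by rw [← hm]; linarith
    have hm2 : (m : ℝ) ≤ 2 := by rw [← hm]; linarith
    have hm0' : 0 ≤ m := by exact_mod_cast hm0
    have hm2' : m ≤ 2 := by exact_mod_cast hm2
    have hpar0 : (2 * v 0 - 1 : ℤ) + m = 2 * v' 0 := by
      have : (2 : ℝ) * v 0 - 1 + m = 2 * v' 0 := by rw [← hm]; exact h0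
      exact_mod_cast this
    have hv0 : v' 0 = v 0 := by omega
    exact ⟨(hv v v').2 ⟨hv0, hv1⟩, rfl⟩
  · exfalso
    have : (2 : ℝ) * v' 1 = 2 * v 1 + 1 := by linarith
    have h2 : (2 * v' 1 : ℤ) = 2 * v 1 + 1 := by exact_mod_cast this
    omega
  · -- k' = 3: reversed vertical edge
    right
    have h1 : (2 : ℝ) * v 1 + 1 = 2 * v' 1 - 2 * t := by linarith
    have ht' : ∃ n : ℤ, (2 : ℝ) * t = n := ⟨2 * v' 1 - 2 * v 1 - 1, by push_cast; linarith⟩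
    obtain ⟨n, hn⟩ := ht'
    have hn0 : (0 : ℝ) ≤ n := by rw [← hn]; linarith
    have hn2 : (n : ℝ) ≤ 2 := by rw [← hn]; linarith
    have hn0' : 0 ≤ n := by exact_mod_cast hn0
    have hn2' : n ≤ 2 := by exact_mod_cast hn2
    have hpar : (2 * v 1 + 1 : ℤ) = 2 * v' 1 - n := by
      have : (2 : ℝ) * v 1 + 1 = 2 * v' 1 - n := by rw [← hn]; exact h1
      exact_mod_cast this
    have hv1 : v' 1 = v 1 + 1 := by omega
    have h0 : (2 : ℝ) * v 0 - 1 + 2 * s = 2 * v' 0 := by linarith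
    have h0' : ∃ m : ℤ, (2 : ℝ) * s = m := ⟨2 * v' 0 - 2 * v 0 + 1, by push_cast; linarith⟩
    obtain ⟨m, hm⟩ := h0'
    have hm0 : (0 : ℝ) ≤ m := by rw [← hm]; linarith
    have hm2 : (m : ℝ) ≤ 2 := by rw [← hm]; linarith
    have hm0' : 0 ≤ m := by exact_mod_cast hm0
    have hm2' : m ≤ 2 := by exact_mod_cast hm2
    have hpar0 : (2 * v 0 - 1 : ℤ) + m = 2 * v' 0 := by
      have : (2 : ℝ) * v 0 - 1 + m = 2 * v' 0 := by rw [← hm]; exact h0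
      exact_mod_cast this
    have hv0 : v' 0 = v 0 := by omega
    refine ⟨(hv _ v').2 ⟨?_, ?_⟩, rfl⟩
    · rw [hunit]; simpa using hv0
    · rw [hunit]; simpa using hv1
  -- k = 2 (west): vertical centre segment at `re = v 0 - 1/2`, `im ∈ [v 1 - 1/2, v 1 + 1/2]`
  · -- k' = 0: horizontal edge from v' eastwards: reversed
    right
    have h1 : (2 : ℝ) * v 1 - 1 + 2 * s = 2 * v' 1 := by linarith
    have h1' : ∃ m : ℤ, (2 : ℝ) * s = m := ⟨2 * v' 1 - 2 * v 1 + 1, by push_cast; linarith⟩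
    obtain ⟨m, hm⟩ := h1'
    have hm0 : (0 : ℝ) ≤ m := by rw [← hm]; linarith
    have hm2 : (m : ℝ) ≤ 2 := by rw [← hm]; linarith
    have hm0' : 0 ≤ m := by exact_mod_cast hm0
    have hm2' : m ≤ 2 := by exact_mod_cast hm2
    have hpar1 : (2 * v 1 - 1 : ℤ) + m = 2 * v' 1 := by
      have : (2 : ℝ) * v 1 - 1 + m = 2 * v' 1 := by rw [← hm]; exact h1
      exact_mod_cast this
    have hv1 : v' 1 = v 1 := by omega
    have h0 : (2 : ℝ) * v 0 - 1 = 2 * v' 0 + 2 * t := by linarith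
    have ht' : ∃ n : ℤ, (2 : ℝ) * t = n := ⟨2 * v 0 - 1 - 2 * v' 0, by push_cast; linarith⟩
    obtain ⟨n, hn⟩ := ht'
    have hn0 : (0 : ℝ) ≤ n := by rw [← hn]; linarith
    have hn2 : (n : ℝ) ≤ 2 := by rw [← hn]; linarith
    have hn0' : 0 ≤ n := by exact_mod_cast hn0
    have hn2' : n ≤ 2 := by exact_mod_cast hn2
    have hpar : (2 * v 0 - 1 : ℤ) = 2 * v' 0 + n := by
      have : (2 : ℝ) * v 0 - 1 = 2 * v' 0 + n := by rw [← hn]; exact h0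
      exact_mod_cast this
    have hv0 : v' 0 = v 0 - 1 := by omega
    refine ⟨(hv _ v').2 ⟨?_, ?_⟩, rfl⟩
    · rw [hunit]; simp; omega
    · rw [hunit]; simpa using hv1
  · exfalso
    have : (2 : ℝ) * v' 0 = 2 * v 0 - 1 := by linarith
    have h2 : (2 * v' 0 : ℤ) = 2 * v 0 - 1 := by exact_mod_cast this
    omega
  · -- k' = 2: the edge itself
    left
    have h1 : (2 : ℝ) * v 1 - 1 + 2 * s = 2 * v' 1 := by linarith
    have h1' : ∃ m : ℤ, (2 : ℝ) * s = m := ⟨2 * v' 1 - 2 * v 1 + 1, by push_cast; linarith⟩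
    obtain ⟨m, hm⟩ := h1'
    have hm0 : (0 : ℝ) ≤ m := by rw [← hm]; linarith
    have hm2 : (m : ℝ) ≤ 2 := by rw [← hm]; linarith
    have hm0' : 0 ≤ m := by exact_mod_cast hm0
    have hm2' : m ≤ 2 := by exact_mod_cast hm2
    have hpar1 : (2 * v 1 - 1 : ℤ) + m = 2 * v' 1 := by
      have : (2 : ℝ) * v 1 - 1 + m = 2 * v' 1 := by rw [← hm]; exact h1
      exact_mod_cast this
    have hv1 : v' 1 = v 1 := by omega
    have h0 : (2 : ℝ) * v 0 - 1 = 2 * v' 0 - 2 * t := by linarith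
    have ht' : ∃ n : ℤ, (2 : ℝ) * t = n := ⟨2 * v' 0 - 2 * v 0 + 1, by push_cast; linarith⟩
    obtain ⟨n, hn⟩ := ht'
    have hn0 : (0 : ℝ) ≤ n := by rw [← hn]; linarith
    have hn2 : (n : ℝ) ≤ 2 := by rw [← hn]; linarith
    have hn0' : 0 ≤ n := by exact_mod_cast hn0
    have hn2' : n ≤ 2 := by exact_mod_cast hn2
    have hpar : (2 * v 0 - 1 : ℤ) = 2 * v' 0 - n := by
      have : (2 : ℝ) * v 0 - 1 = 2 * v' 0 - n := by rw [← hn]; exact h0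
      exact_mod_cast this
    have hv0 : v' 0 = v 0 := by omega
    exact ⟨(hv v v').2 ⟨hv0, hv1⟩, rfl⟩
  · exfalso
    have : (2 : ℝ) * v' 0 = 2 * v 0 - 1 := by linarith
    have h2 : (2 * v' 0 : ℤ) = 2 * v 0 - 1 := by exact_mod_cast this
    omega
  -- k = 3 (south): horizontal centre segment at `im = v 1 - 1/2`
  · exfalso
    have : (2 : ℝ) * v' 1 = 2 * v 1 - 1 := by linarith
    have h2 : (2 * v' 1 : ℤ) = 2 * v 1 - 1 := by exact_mod_cast this
    omega
  · -- k' = 1: vertical edge from v' upwards: reversed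
    right
    have h0 : (2 : ℝ) * v 0 + 1 - 2 * s = 2 * v' 0 := by linarith
    have h0' : ∃ m : ℤ, (2 : ℝ) * s = m := ⟨2 * v 0 + 1 - 2 * v' 0, by push_cast; linarith⟩
    obtain ⟨m, hm⟩ := h0'
    have hm0 : (0 : ℝ) ≤ m := by rw [← hm]; linarith
    have hm2 : (m : ℝ) ≤ 2 := by rw [← hm]; linarith
    have hm0' : 0 ≤ m := by exact_mod_cast hm0
    have hm2' : m ≤ 2 := by exact_mod_cast hm2
    have hpar0 : (2 * v 0 + 1 : ℤ) - m = 2 * v' 0 := by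
      have : (2 : ℝ) * v 0 + 1 - m = 2 * v' 0 := by rw [← hm]; exact h0
      exact_mod_cast this
    have hv0 : v' 0 = v 0 := by omega
    have h1 : (2 : ℝ) * v 1 - 1 = 2 * v' 1 + 2 * t := by linarith
    have ht' : ∃ n : ℤ, (2 : ℝ) * t = n := ⟨2 * v 1 - 1 - 2 * v' 1, by push_cast; linarith⟩
    obtain ⟨n, hn⟩ := ht'
    have hn0 : (0 : ℝ) ≤ n := by rw [← hn]; linarith
    have hn2 : (n : ℝ) ≤ 2 := by rw [← hn]; linarith
    have hn0' : 0 ≤ n := by exact_mod_cast hn0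
    have hn2' : n ≤ 2 := by exact_mod_cast hn2
    have hpar : (2 * v 1 - 1 : ℤ) = 2 * v' 1 + n := by
      have : (2 : ℝ) * v 1 - 1 = 2 * v' 1 + n := by rw [← hn]; exact h1
      exact_mod_cast this
    have hv1 : v' 1 = v 1 - 1 := by omega
    refine ⟨(hv _ v').2 ⟨?_, ?_⟩, rfl⟩
    · rw [hunit]; simpa using hv0
    · rw [hunit]; simp; omega
  · exfalso
    have : (2 : ℝ) * v' 1 = 2 * v 1 - 1 := by linarith
    have h2 : (2 * v' 1 : ℤ) = 2 * v 1 - 1 := by exact_mod_cast this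
    omega
  · -- k' = 3: the edge itself
    left
    have h0 : (2 : ℝ) * v 0 + 1 - 2 * s = 2 * v' 0 := by linarith
    have h0' : ∃ m : ℤ, (2 : ℝ) * s = m := ⟨2 * v 0 + 1 - 2 * v' 0, by push_cast; linarith⟩
    obtain ⟨m, hm⟩ := h0'
    have hm0 : (0 : ℝ) ≤ m := by rw [← hm]; linarith
    have hm2 : (m : ℝ) ≤ 2 := by rw [← hm]; linarith
    have hm0' : 0 ≤ m := by exact_mod_cast hm0
    have hm2' : m ≤ 2 := by exact_mod_cast hm2
    have hpar0 : (2 * v 0 + 1 : ℤ) - m = 2 * v' 0 := by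
      have : (2 : ℝ) * v 0 + 1 - m = 2 * v' 0 := by rw [← hm]; exact h0
      exact_mod_cast this
    have hv0 : v' 0 = v 0 := by omega
    have h1 : (2 : ℝ) * v 1 - 1 = 2 * v' 1 - 2 * t := by linarith
    have ht' : ∃ n : ℤ, (2 : ℝ) * t = n := ⟨2 * v' 1 - 2 * v 1 + 1, by push_cast; linarith⟩
    obtain ⟨n, hn⟩ := ht'
    have hn0 : (0 : ℝ) ≤ n := by rw [← hn]; linarith
    have hn2 : (n : ℝ) ≤ 2 := by rw [← hn]; linarith
    have hn0' : 0 ≤ n := by exact_mod_cast hn0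
    have hn2' : n ≤ 2 := by exact_mod_cast hn2
    have hpar : (2 * v 1 - 1 : ℤ) = 2 * v' 1 - n := by
      have : (2 : ℝ) * v 1 - 1 = 2 * v' 1 - n := by rw [← hn]; exact h1
      exact_mod_cast this
    have hv1 : v' 1 = v 1 := by omega
    exact ⟨(hv v v').2 ⟨hv0, hv1⟩, rfl⟩


/-- The edge and the centre segment of `(v, k)` meet only at the midpoint. [folklore] -/
theorem eq_emid_of_mem_edgeSeg_of_mem_ctrSeg {v : Site 2} {k : Fin 4} {p : ℂ} (hp : p ∈ ctrSeg v k)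
    (hp' : p ∈ edgeSeg v k) : p = emid v k := by
  obtain ⟨s, hs0, hs1, hps⟩ := exists_of_mem_ctrSeg hp
  obtain ⟨t, ht0, ht1, hpt⟩ := exists_of_mem_edgeSeg hp'
  have heq := hps.symm.trans hpt
  rw [Complex.ext_iff] at heq
  obtain ⟨hre, him⟩ := heq
  simp only [Complex.add_re, Complex.add_im, Complex.sub_re, Complex.sub_im, Complex.mul_re,
    Complex.mul_im, Complex.ofReal_re, Complex.ofReal_im, zero_mul, sub_zero, add_zero] at hre him
  rw [ctr_right_re, ctr_left_re, Site.toComplex_re v] at hre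
  rw [ctr_right_im, ctr_left_im, Site.toComplex_im v] at him
  have ht : t = 1 / 2 := by
    fin_cases k <;> norm_num [toComplex_cornerUnit_table] at hre him <;> linarith
  rw [hpt, emid, ht]
  push_cast
  ring

/-- The midpoint lies on the edge. [folklore] -/
theorem emid_mem_edgeSeg (v : Site 2) (k : Fin 4) : emid v k ∈ edgeSeg v k := by
  rw [edgeSeg, segment_eq_image_lineMap]
  refine ⟨1 / 2, ⟨by norm_num, by norm_num⟩, ?_⟩
  simp only [AffineMap.lineMap_apply_module', toComplex_add, add_sub_cancel_left, Complex.real_smul, emid]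
  push_cast
  ring

/-- The midpoint lies strictly between the two centres. [folklore] -/
theorem emid_mem_openSegment_ctr (v : Site 2) (k : Fin 4) :
    emid v k ∈ openSegment ℝ (ctr (faceAt v k)) (ctr (faceAt v (k + 3))) := by
  rw [openSegment_eq_image_lineMap]
  refine ⟨1 / 2, ⟨by norm_num, by norm_num⟩, ?_⟩
  apply Complex.ext
  · simp only [AffineMap.lineMap_apply_module', Complex.add_re, Complex.sub_re, Complex.real_smul,
      Complex.mul_re, Complex.ofReal_re, Complex.ofReal_im, zero_mul, sub_zero]
    rw [ctr_right_re, ctr_left_re, emid, Complex.add_re, Site.toComplex_re v]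
    fin_cases k <;> norm_num [toComplex_cornerUnit_table]
  · simp only [AffineMap.lineMap_apply_module', Complex.add_im, Complex.sub_im, Complex.real_smul,
      Complex.mul_im, Complex.ofReal_re, Complex.ofReal_im, zero_mul, add_zero]
    rw [ctr_right_im, ctr_left_im, emid, Complex.add_im, Site.toComplex_im v]
    fin_cases k <;> norm_num [toComplex_cornerUnit_table]

/-- The start of the edge is on the positive side of the oriented centre segment. [folklore] -/
theorem segSide_ctr_start_pos (v : Site 2) (k : Fin 4) :
    0 < segSide (ctr (faceAt v k)) (ctr (faceAt v (k + 3))) (Site.toComplex v) := by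
  rw [segSide_eq]
  simp only [Complex.sub_re, Complex.sub_im]
  rw [ctr_right_re, ctr_right_im, ctr_left_re, ctr_left_im, Site.toComplex_re, Site.toComplex_im]
  fin_cases k <;> norm_num

/-- The end of the edge is on the negative side of the oriented centre segment. [folklore] -/
theorem segSide_ctr_end_neg (v : Site 2) (k : Fin 4) :
    segSide (ctr (faceAt v k)) (ctr (faceAt v (k + 3))) (Site.toComplex (v + cornerUnit k)) < 0 := by
  rw [segSide_eq]
  simp only [Complex.sub_re, Complex.sub_im]
  rw [ctr_right_re, ctr_right_im, ctr_left_re, ctr_left_im, toComplex_add, Complex.add_re, Complex.add_im,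
    Site.toComplex_re, Site.toComplex_im]
  fin_cases k <;> norm_num [toComplex_cornerUnit_table]

/-! ### Sides of the cells of an edge -/

section Sides

variable {U : Finset (Site 2)} {d₀ : Site 2 × Fin 4} (h₀ : IsBd U d₀)

/-- The darts of the orbit in terms of `vert`/`dirAt`. [folklore] -/
theorem bdOrbit_eq (i : ℕ) : bdOrbit U d₀ i = (vert U d₀ i, dirAt U d₀ i) := rfl

/-- **Cells of an untraced edge are on the same side.**  If neither orientation of the edge
`(v, k)` is a dart of the traced orbit, the centre segment misses the loop, so both centres are
inside or both outside. [folklore] -/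
theorem ctr_mem_inside_iff_of_not_traced (hP : PinchFree U) {v : Site 2} {k : Fin 4}
    (h1 : ∀ i < period h₀, bdOrbit U d₀ i ≠ (v, k))
    (h2 : ∀ i < period h₀, bdOrbit U d₀ i ≠ (v + cornerUnit k, k + 2)) :
    ctr (faceAt v k) ∈ IsJordanLoop.inside (bdLoop U d₀ h₀) ↔
      ctr (faceAt v (k + 3)) ∈ IsJordanLoop.inside (bdLoop U d₀ h₀) := by
  have hJ := isJordanLoop_bdLoop h₀ hP
  have hdisj : ctrSeg v k ⊆ (range (bdLoop U d₀ h₀))ᶜ := by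
    intro p hp hpr
    obtain ⟨i, hi, hpi⟩ := exists_edge_of_mem_range h₀ hpr
    rcases edge_eq_of_mem_ctrSeg hp hpi with ⟨hv, hk⟩ | ⟨hv, hk⟩
    · exact h1 i hi (by rw [bdOrbit_eq, hv, hk])
    · exact h2 i hi (by rw [bdOrbit_eq, hv, hk])
  have hpc : IsPreconnected (ctrSeg v k) := (convex_segment _ _).isPreconnected
  have hl : ctr (faceAt v k) ∈ ctrSeg v k := left_mem_segment _ _ _
  have hr : ctr (faceAt v (k + 3)) ∈ ctrSeg v k := right_mem_segment _ _ _
  rcases hJ.subset_inside_or_subset_outside hpc hdisj with h | h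
  · exact ⟨fun _ => h hr, fun _ => h hl⟩
  · constructor
    · intro hin; exact absurd hin (fun hin => Set.disjoint_left.1 IsJordanLoop.disjoint_inside_outside hin (h hl))
    · intro hin; exact absurd hin (fun hin => Set.disjoint_left.1 IsJordanLoop.disjoint_inside_outside hin (h hr))

/-- **The winding number jumps by one across a traced edge**: with `ℓ`, `r` the centres of the
left and right cells of the `i`-th traced dart, `wind (γ - ℓ) - wind (γ - r) = 1`. [folklore] -/
theorem wind_left_sub_wind_right (hP : PinchFree U) {i : ℕ} (hi : i < period h₀) :
    wind (fun τ => bdLoop U d₀ h₀ τ - ctr (faceAt (vert U d₀ i) (dirAt U d₀ i))) -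
      wind (fun τ => bdLoop U d₀ h₀ τ - ctr (faceAt (vert U d₀ i) (dirAt U d₀ i + 3))) = 1 := by
  have hJ := isJordanLoop_bdLoop h₀ hP
  set L := bdLoop U d₀ h₀ with hL
  set v := vert U d₀ i
  set k := dirAt U d₀ i
  set P : ℝ := (period h₀ : ℝ) with hPdef
  have hP0 : (0 : ℝ) < P := by rw [hPdef]; exact_mod_cast period_pos h₀
  set u : ℝ := i / P with hu
  set u' : ℝ := (i + 1) / P with hu'
  have hiP : (i : ℝ) + 1 ≤ P := by rw [hPdef]; exact_mod_cast hi
  have hau : 0 ≤ u := div_nonneg (by positivity) hP0.le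
  have huu' : u < u' := by rw [hu, hu']; exact div_lt_div_of_pos_right (by linarith) hP0
  have hu'b : u' ≤ 1 := by rw [hu', div_le_one hP0]; exact hiP
  have hLu : L u = Site.toComplex v := by
    have := bdLoop_apply_div h₀ hi (θ := 0) ⟨le_rfl, zero_le_one⟩
    simpa [hu] using this
  have hLu' : L u' = Site.toComplex (v + cornerUnit k) := by
    have := bdLoop_apply_div h₀ hi (θ := 1) ⟨zero_le_one, le_rfl⟩
    simpa [hu'] using this
  have hmid : ∀ s ∈ Icc u u', L s = AffineMap.lineMap (L u) (L u') ((s - u) / (u' - u)) := by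
    intro s hs
    have hd : u' - u = 1 / P := by rw [hu, hu']; field_simp; ring
    set θ : ℝ := (s - u) / (u' - u) with hθ
    have hθI : θ ∈ Icc (0 : ℝ) 1 :=
      ⟨div_nonneg (sub_nonneg.2 hs.1) (sub_pos.2 huu').le,
        (div_le_one (sub_pos.2 huu')).2 (sub_le_sub_right hs.2 _)⟩
    have hs_eq : s = (i + θ) / P := by
      rw [hθ, hd, hu]; field_simp; ring
    rw [hLu, hLu', hs_eq]
    exact bdLoop_apply_div h₀ hi hθI
  set ℓ := ctr (faceAt v k)
  set r := ctr (faceAt v (k + 3))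
  -- the loop meets the centre segment only at the midpoint, at time `(i + 1/2)/P`
  have hout : ∀ s ∈ Icc 0 u ∪ Icc u' 1, L s ∉ segment ℝ ℓ r := by
    intro s hs hmem
    have hsI : s ∈ Icc (0 : ℝ) 1 := by
      rcases hs with hs | hs
      · exact ⟨hs.1, hs.2.trans (huu'.le.trans hu'b)⟩
      · exact ⟨hau.trans (huu'.le.trans hs.1), hs.2⟩
    obtain ⟨j, hj, hpj⟩ := exists_edge_of_mem_range h₀ ⟨s, rfl⟩
    have hji : j = i := by
      rcases edge_eq_of_mem_ctrSeg hmem hpj with ⟨hv, hk⟩ | ⟨hv, hk⟩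
      · exact bdOrbit_injOn h₀ (mem_Iio.2 hj) (mem_Iio.2 hi) (by rw [bdOrbit_eq, bdOrbit_eq, hv, hk])
      · exact (not_backtrack h₀ i j hv hk).elim
    subst hji
    have hmidpt : L s = emid v k := eq_emid_of_mem_edgeSeg_of_mem_ctrSeg hmem hpj
    have hhalf : L ((j + 1 / 2) / P) = emid v k := by
      have := bdLoop_apply_div h₀ hi (θ := 1 / 2) ⟨by norm_num, by norm_num⟩
      rw [hL, hPdef, this]
      have := emid_mem_edgeSeg v k
      simp only [AffineMap.lineMap_apply_module', emid, toComplex_add, add_sub_cancel_left, Complex.real_smul]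
      push_cast; ring
    have ht_mem : (j + 1 / 2) / P ∈ Ico (0 : ℝ) 1 :=
      ⟨div_nonneg (by positivity) hP0.le, (div_lt_one hP0).2 (by linarith)⟩
    have ht_in : u < (j + 1 / 2) / P ∧ (j + 1 / 2) / P < u' := by
      rw [hu, hu']
      exact ⟨div_lt_div_of_pos_right (by linarith) hP0, div_lt_div_of_pos_right (by linarith) hP0⟩
    rcases hsI.2.lt_or_eq with hs1 | hs1
    · have hseq : s = (j + 1 / 2) / P :=
        hJ.injOn ⟨hsI.1, hs1⟩ ht_mem (hmidpt.trans hhalf.symm)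
      rcases hs with hs | hs
      · linarith [hs.2, ht_in.1]
      · linarith [hs.1, ht_in.2]
    · -- `s = 1`: then `L 0 = L 1 = midpoint`, at time `0 ≠ (j + 1/2)/P`
      have h01 : L 0 = L s := by rw [hs1]; exact hJ.eq_zero_one
      have hseq : (0 : ℝ) = (j + 1 / 2) / P :=
        hJ.injOn ⟨le_rfl, zero_lt_one⟩ ht_mem (h01.trans (hmidpt.trans hhalf.symm))
      have : (0 : ℝ) < (j + 1 / 2) / P := by positivity
      linarith
  have hA : 0 < segSide ℓ r (L u) := by rw [hLu]; exact segSide_ctr_start_pos v k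
  have hB : segSide ℓ r (L u') < 0 := by rw [hLu']; exact segSide_ctr_end_neg v k
  have hx : ∃ p ∈ segment ℝ (L u) (L u'), p ∈ openSegment ℝ ℓ r :=
    ⟨emid v k, by rw [hLu, hLu']; exact emid_mem_edgeSeg v k, emid_mem_openSegment_ctr v k⟩
  have key := wind_sub_wind_of_straight_cross hau huu' hu'b (hJ.continuous.continuousOn)
    hJ.eq_zero_one hmid hout hA hB hx
  simp only [zero_add, sub_zero, mul_one] at key
  exact key

/-- **The two cells of a traced edge are on opposite sides.** [folklore] -/
theorem left_mem_inside_iff_right_not_mem (hP : PinchFree U) {i : ℕ} (hi : i < period h₀) :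
    ctr (faceAt (vert U d₀ i) (dirAt U d₀ i)) ∈ IsJordanLoop.inside (bdLoop U d₀ h₀) ↔
      ctr (faceAt (vert U d₀ i) (dirAt U d₀ i + 3)) ∉ IsJordanLoop.inside (bdLoop U d₀ h₀) := by
  have hJ := isJordanLoop_bdLoop h₀ hP
  set ℓ := ctr (faceAt (vert U d₀ i) (dirAt U d₀ i))
  set r := ctr (faceAt (vert U d₀ i) (dirAt U d₀ i + 3))
  have hℓ : ℓ ∉ range (bdLoop U d₀ h₀) := ctr_not_mem_range h₀ _
  have hr : r ∉ range (bdLoop U d₀ h₀) := ctr_not_mem_range h₀ _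
  have hjump : wind (fun τ => bdLoop U d₀ h₀ τ - ℓ) - wind (fun τ => bdLoop U d₀ h₀ τ - r) = 1 :=
    wind_left_sub_wind_right h₀ hP hi
  constructor
  · intro hℓin hrin
    -- both inside: equal winding numbers
    have hreq : r ∈ connectedComponentIn (range (bdLoop U d₀ h₀))ᶜ ℓ := by
      rw [← hJ.inside_eq_connectedComponentIn hℓin]; exact hrin
    have heq := wind_sub_eq_of_mem_connectedComponentIn hJ.continuous.continuousOn hJ.eq_zero_one
      hJ.isCompact_range.isClosed (fun t _ => mem_range_self t) hreq
    rw [heq] at hjump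
    omega
  · intro hrout
    by_contra hℓout
    have hℓ0 := (hJ.mem_outside_iff_wind_eq_zero hℓ).1
      ((IsJordanLoop.mem_inside_or_mem_outside hℓ).resolve_left hℓout)
    have hr0 := (hJ.mem_outside_iff_wind_eq_zero hr).1
      ((IsJordanLoop.mem_inside_or_mem_outside hr).resolve_left hrout)
    rw [hℓ0, hr0] at hjump
    omega

end Sides

/-! ### Edge-connected complexes without holes: a single boundary cycle -/

/-- Two cells are **edge-adjacent**: they are the left and right cells of some unit edge. [folklore] -/
def CellAdj (a b : Site 2) : Prop := ∃ (v : Site 2) (k : Fin 4), a = faceAt v k ∧ b = faceAt v (k + 3)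

/-- Edge-adjacency is symmetric. [folklore] -/
theorem CellAdj.symm {a b : Site 2} (h : CellAdj a b) : CellAdj b a := by
  obtain ⟨v, k, rfl, rfl⟩ := h
  refine ⟨v + cornerUnit k, k + 2, ?_, ?_⟩
  · rw [faceAt_add_unit_add_two]
  · rw [fin4_add_two_add_three, faceAt_add_unit_succ]

/-- `U` is **edge-connected**. [folklore] -/
def EdgeConn (U : Finset (Site 2)) : Prop := ∀ a ∈ U, ∀ b ∈ U, Relation.ReflTransGen (fun x y => x ∈ U ∧ y ∈ U ∧ CellAdj x y) a b

/-- **No holes, combinatorially**: every cell outside `U` but edge-adjacent to a cell of `U` is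
joined, through edge-adjacent cells outside `U`, to cells arbitrarily far away. [folklore] -/
def CoHoleFree (U : Finset (Site 2)) : Prop := ∀ o, o ∉ U → (∃ c ∈ U, CellAdj c o) → ∀ R : ℝ, ∃ o',
  R < ‖ctr o'‖ ∧ Relation.ReflTransGen (fun x y => x ∉ U ∧ y ∉ U ∧ CellAdj x y) o o'

section Global

variable {U : Finset (Site 2)} {d₀ : Site 2 × Fin 4} (h₀ : IsBd U d₀)

/-- An edge both of whose cells are outside `U`, or both inside `U`, is traced in neither
orientation. [folklore] -/
theorem not_traced_of_same {v : Site 2} {k : Fin 4}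
    (h : (faceAt v k ∈ U ∧ faceAt v (k + 3) ∈ U) ∨ (faceAt v k ∉ U ∧ faceAt v (k + 3) ∉ U)) :
    (∀ i < period h₀, bdOrbit U d₀ i ≠ (v, k)) ∧
      ∀ i < period h₀, bdOrbit U d₀ i ≠ (v + cornerUnit k, k + 2) := by
  constructor
  · intro i _ heq
    have hb := isBd_bdOrbit h₀ i
    rw [heq] at hb
    obtain ⟨hL, hR⟩ := hb
    rcases h with ⟨-, h2⟩ | ⟨h1, -⟩
    · exact hR h2
    · exact h1 hL
  · intro i _ heq
    have hb := isBd_bdOrbit h₀ i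
    rw [heq] at hb
    obtain ⟨hL, hR⟩ := hb
    simp only at hL hR
    rw [faceAt_add_unit_add_two] at hL
    rw [fin4_add_two_add_three, faceAt_add_unit_succ] at hR
    rcases h with ⟨h1, -⟩ | ⟨-, h2⟩
    · exact hR h1
    · exact h2 hL

/-- Adjacent cells both in `U` or both outside `U` are on the same side of the loop. [folklore] -/
theorem ctr_mem_inside_iff_of_cellAdj (hP : PinchFree U) {a b : Site 2} (hab : CellAdj a b)
    (h : (a ∈ U ∧ b ∈ U) ∨ (a ∉ U ∧ b ∉ U)) :
    ctr a ∈ IsJordanLoop.inside (bdLoop U d₀ h₀) ↔ ctr b ∈ IsJordanLoop.inside (bdLoop U d₀ h₀) := by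
  obtain ⟨v, k, rfl, rfl⟩ := hab
  obtain ⟨h1, h2⟩ := not_traced_of_same h₀ h
  exact ctr_mem_inside_iff_of_not_traced h₀ hP h1 h2

/-- Far away centres are outside the loop. [folklore] -/
theorem exists_radius_outside (hP : PinchFree U) : ∃ R : ℝ, ∀ o : Site 2, R < ‖ctr o‖ →
    ctr o ∈ IsJordanLoop.outside (bdLoop U d₀ h₀) := by
  have hJ := isJordanLoop_bdLoop h₀ hP
  obtain ⟨R, hR⟩ := hJ.isCompact_range.isBounded.subset_closedBall (0 : ℂ)
  exact ⟨R, fun o ho => IsJordanLoop.mem_outside_of_lt_norm hR ho⟩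

/-- A chain of cells outside `U` keeps the side. [folklore] -/
theorem ctr_mem_inside_iff_of_chain_compl (hP : PinchFree U) {o o' : Site 2}
    (h : Relation.ReflTransGen (fun x y => x ∉ U ∧ y ∉ U ∧ CellAdj x y) o o') :
    ctr o ∈ IsJordanLoop.inside (bdLoop U d₀ h₀) ↔ ctr o' ∈ IsJordanLoop.inside (bdLoop U d₀ h₀) := by
  induction h with
  | refl => exact Iff.rfl
  | tail _ hst ih => exact ih.trans (ctr_mem_inside_iff_of_cellAdj h₀ hP hst.2.2 (Or.inr ⟨hst.1, hst.2.1⟩))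

/-- A chain of cells of `U` keeps the side. [folklore] -/
theorem ctr_mem_inside_iff_of_chain (hP : PinchFree U) {a b : Site 2}
    (h : Relation.ReflTransGen (fun x y => x ∈ U ∧ y ∈ U ∧ CellAdj x y) a b) :
    ctr a ∈ IsJordanLoop.inside (bdLoop U d₀ h₀) ↔ ctr b ∈ IsJordanLoop.inside (bdLoop U d₀ h₀) := by
  induction h with
  | refl => exact Iff.rfl
  | tail _ hst ih => exact ih.trans (ctr_mem_inside_iff_of_cellAdj h₀ hP hst.2.2 (Or.inl ⟨hst.1, hst.2.1⟩))

/-- Under `CoHoleFree`, a non-`U` cell adjacent to `U` is outside the loop. [folklore] -/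
theorem ctr_not_mem_inside_of_coHoleFree (hP : PinchFree U) (hH : CoHoleFree U) {o : Site 2} (ho : o ∉ U)
    (hadj : ∃ c ∈ U, CellAdj c o) : ctr o ∉ IsJordanLoop.inside (bdLoop U d₀ h₀) := by
  obtain ⟨R, hR⟩ := exists_radius_outside h₀ hP
  obtain ⟨o', ho', hchain⟩ := hH o ho hadj R
  intro hin
  have hin' := (ctr_mem_inside_iff_of_chain_compl h₀ hP hchain).1 hin
  exact Set.disjoint_left.1 IsJordanLoop.disjoint_inside_outside hin' (hR o' ho')

/-- **All cells of `U` are inside the traced loop** (edge-connected, no holes). [folklore] -/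
theorem ctr_mem_inside_of_mem (hP : PinchFree U) (hE : EdgeConn U) (hH : CoHoleFree U) {c : Site 2} (hc : c ∈ U) :
    ctr c ∈ IsJordanLoop.inside (bdLoop U d₀ h₀) := by
  -- the left cell of the start dart is inside: its right cell is outside and the sides differ
  have hL0 : faceAt d₀.1 d₀.2 ∈ U := h₀.1
  have hR0 : faceAt d₀.1 (d₀.2 + 3) ∉ U := h₀.2
  have hadj0 : ∃ c ∈ U, CellAdj c (faceAt d₀.1 (d₀.2 + 3)) := ⟨_, hL0, d₀.1, d₀.2, rfl, rfl⟩
  have hout0 := ctr_not_mem_inside_of_coHoleFree h₀ hP hH hR0 hadj0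
  have hin0 : ctr (faceAt d₀.1 d₀.2) ∈ IsJordanLoop.inside (bdLoop U d₀ h₀) :=
    (left_mem_inside_iff_right_not_mem h₀ hP (i := 0) (period_pos h₀)).2 hout0
  exact (ctr_mem_inside_iff_of_chain h₀ hP (hE _ hL0 _ hc)).1 hin0

/-- **Single boundary cycle**: in an edge-connected pinch-free complex without holes every boundary
dart is a dart of the traced orbit. [folklore] -/
theorem exists_eq_bdOrbit_of_isBd (hP : PinchFree U) (hE : EdgeConn U) (hH : CoHoleFree U) {d : Site 2 × Fin 4}
    (hd : IsBd U d) : ∃ i < period h₀, bdOrbit U d₀ i = d := by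
  by_contra hnone
  push Not at hnone
  obtain ⟨v, k⟩ := d
  obtain ⟨hL, hR⟩ := hd
  simp only at hL hR
  -- neither orientation is traced: the reverse is not even a boundary dart
  have h2 : ∀ i < period h₀, bdOrbit U d₀ i ≠ (v + cornerUnit k, k + 2) := by
    intro i _ heq
    have hb := isBd_bdOrbit h₀ i
    rw [heq] at hb
    have := hb.1
    simp only at this
    rw [faceAt_add_unit_add_two] at this
    exact hR this
  have hsame := ctr_mem_inside_iff_of_not_traced h₀ hP hnone h2
  have hin : ctr (faceAt v k) ∈ IsJordanLoop.inside (bdLoop U d₀ h₀) := ctr_mem_inside_of_mem h₀ hP hE hH hL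
  have hout : ctr (faceAt v (k + 3)) ∉ IsJordanLoop.inside (bdLoop U d₀ h₀) :=
    ctr_not_mem_inside_of_coHoleFree h₀ hP hH hR ⟨_, hL, v, k, rfl, rfl⟩
  exact hout (hsame.1 hin)

end Global

end CellComplex

end Literature.Probability.Percolation

end
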